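import Summits.ValiantsHypothesis.Statement
import Summits.ValiantsHypothesis.ValiantsHypothesis.Theorems.HubHub
import Literature.Computability.AlgebraicComplexity.OrbitClosureProofs
import Literature.Computability.AlgebraicComplexity.DeterminantalComplexityProofs
import Literature.Computability.AlgebraicComplexity.VPDeterminantalQPProofs
import Literature.Computability.AlgebraicComplexity.ValiantClasses
import Literature.Computability.AlgebraicComplexity.ValiantConjectureProofs

/-!
# `GctBridge` / `GctToVH` (item `stmt-ValiantsHypothesis-0983`): the quasi-polynomial
# Mulmuley–Sohoni thesis implies Valiant's hypothesis

Shared support item of the routes `BorderApolarity` (decl `GctBridge`), `IntegralGCT` and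
`ValuativeGCT` (decl `GctToVH`) of the sub-problem `ValiantsHypothesis`:

  `(∀ c, ∃ n₀, ∀ n ≥ n₀, ∀ m, n ≤ m ≤ 2^((log₂ n + c)^c) → X₀₀^(m-n) per_n ∉ Δ(det_m)) → VP_ℂ ≠ VNP_ℂ`.

The hypothesis is verbatim the quasi-polynomial Mulmuley–Sohoni thesis `GCTMult.GctThesis`
(Mulmuley–Sohoni 2001, §4; the "window" `n ≤ m ≤ 2^((log₂ n + c)^c)` of padded permanents
`paddedPerPoly ℂ n m = X₀₀^(m-n) per_n` against the orbit closure `Δ(det_m)` of the determinant).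

Proof — pure bookkeeping over DISCHARGED named facts:

1. `not_isQPBounded_dc_per_of_thesis`: the thesis makes `n ↦ dc(per_n)` NOT quasi-polynomially
   bounded. A bound `dc(per_n) ≤ 2^((log₂ n + c)^c)` gives, at `n := n₀(c+1)` and
   `m := max (dc per_n) (max n 1)`, an affine determinantal representation of `per_n` of size `m`
   (attainment `hasDetRepr_determinantalComplexity_holds` and padding `HasDetRepr.mono_holds`,
   Mignon–Ressayre 2004 §1, resting on Valiant universality) with
   `n ≤ m ≤ 2^((log₂ n + (c+1))^(c+1))`, hence `X₀₀^(m-n) per_n ∈ Δ(det_m)` by Mulmuley–Sohoni 2001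
   Prop. 4.4 (`paddedPerPoly_mem_orbitClosure_detPoly_of_hasDetRepr_holds`) — contradicting the
   thesis at `c + 1`. (This is the glue `Literature.CplxAlg.gct_assembly` of
   `Theorems/GCTMultAssembly.lean`, re-proved inline with the facts fed by their discharges, so
   that this file imports only debt-free modules.)
2. `gctBridge_proof`: `VP ⟹ dc quasi-polynomially bounded`
   (`isQPBounded_determinantalComplexity_of_isVPFamily_holds`; Bürgisser–Clausen–Shokrollahi 1997,
   Cor. (21.40)) turns step 1 into `¬ IsVPFamily (per_n)_n`, and the hub lemma
   `Summit.ValiantsHypothesis.Hub.valiantsHypothesis_of_not_isVPFamily_per` (`Theorems/HubHub.lean`)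
   fed with the renaming bridge `mem_VP_ofFintype_iff_holds` and Valiant's theorem
   `perFamily_mem_VNP_holds ℂ` (`per ∈ VNP`) gives `VP ℂ ≠ VNP ℂ`.

Design notes. The closing theorem `gctBridge_proof` is stated against the item's signature
VERBATIM and this file imports NO `Theses` file, so that the gate can link `GctBridge_holds` /
`GctToVH_holds` into all three route files without an import cycle. Imports are the debt-free
set named by the planner's retriage note (no `…AlgebraicComplexity.GCT`,
`…PermanentVsDeterminant`, `…BIPNoOccurrence`, `Theorems.GCTMultAssembly`, whose open named facts
would re-enter the routes' cones): `OrbitClosureProofs`, `DeterminantalComplexityProofs`,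
`VPDeterminantalQPProofs`, `ValiantClasses`, `ValiantConjectureProofs`, `Theorems.HubHub`.
-/

namespace Summit.ValiantsHypothesis.ValiantsHypothesis.Theorems.BorderApolarityGctBridge

open Literature.Computability.AlgebraicComplexity

/-- Padding a quasi-polynomial exponent: `(a + c)^c ≤ (a + (c + 1))^(c + 1)`. [folklore] -/
theorem add_pow_le_add_succ_pow_succ (a c : ℕ) : (a + c) ^ c ≤ (a + (c + 1)) ^ (c + 1) :=
  calc (a + c) ^ c ≤ (a + (c + 1)) ^ c := Nat.pow_le_pow_left (by omega) c
    _ ≤ (a + (c + 1)) ^ (c + 1) := Nat.pow_le_pow_right (by omega) (by omega)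

/-- Every `n` lies in the next quasi-polynomial window: `n ≤ 2 ^ ((log₂ n + (c + 1)) ^ (c + 1))`
(from `n < 2 ^ (log₂ n + 1)`). [folklore] -/
theorem le_two_pow_log_add_succ_pow (n c : ℕ) :
    n ≤ 2 ^ ((Nat.log 2 n + (c + 1)) ^ (c + 1)) := by
  have h1 : n < 2 ^ (Nat.log 2 n + 1) := Nat.lt_pow_succ_log_self (by norm_num) n
  have h2 : Nat.log 2 n + 1 ≤ (Nat.log 2 n + (c + 1)) ^ (c + 1) :=
    calc Nat.log 2 n + 1 ≤ Nat.log 2 n + (c + 1) := by omega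
      _ ≤ (Nat.log 2 n + (c + 1)) ^ (c + 1) := Nat.le_self_pow (by omega) _
  exact h1.le.trans (Nat.pow_le_pow_right (by norm_num) h2)

/-- **Step 1 (the `gct_assembly` glue, unconditional).** The quasi-polynomial Mulmuley–Sohoni
thesis implies that `n ↦ dc(per_n)` is not quasi-polynomially bounded: a bound with constant `c`
yields, at `n := n₀(c+1)` and `m := max (dc per_n) (max n 1)`, an affine determinantal
representation of `per_n` of size `m` (attainment `hasDetRepr_determinantalComplexity_holds`,
padding `HasDetRepr.mono_holds`) with `n ≤ m ≤ 2^((log₂ n + (c+1))^(c+1))`, hence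
`X₀₀^(m-n) per_n ∈ Δ(det_m)` by Mulmuley–Sohoni 2001, Prop. 4.4
(`paddedPerPoly_mem_orbitClosure_detPoly_of_hasDetRepr_holds`), contradicting the thesis.
[folklore] -/
theorem not_isQPBounded_dc_per_of_thesis
    (hX : ∀ c : ℕ, ∃ n₀ : ℕ, ∀ n ≥ n₀, ∀ (m : ℕ) [NeZero m], n ≤ m →
      m ≤ 2 ^ ((Nat.log 2 n + c) ^ c) →
        paddedPerPoly ℂ n m ∉ orbitClosure (detPoly (Fin m) ℂ)) :
    ¬ IsQPBounded (fun n => determinantalComplexity (perPoly (Fin n) ℂ)) := by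
  rintro ⟨c, hc⟩
  obtain ⟨n, hn₀⟩ := hX (c + 1)
  set t := determinantalComplexity (perPoly (Fin n) ℂ) with ht
  set m := max t (max n 1) with hm
  haveI : NeZero m := NeZero.of_pos (by omega)
  have hnm : n ≤ m := by omega
  have htm : t ≤ m := le_max_left _ _
  have hbound : m ≤ 2 ^ ((Nat.log 2 n + (c + 1)) ^ (c + 1)) := by
    have h1 : t ≤ 2 ^ ((Nat.log 2 n + (c + 1)) ^ (c + 1)) :=
      (hc n).trans (Nat.pow_le_pow_right (by norm_num) (add_pow_le_add_succ_pow_succ _ _))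
    have h2 : n ≤ 2 ^ ((Nat.log 2 n + (c + 1)) ^ (c + 1)) := le_two_pow_log_add_succ_pow n c
    have h3 : 1 ≤ 2 ^ ((Nat.log 2 n + (c + 1)) ^ (c + 1)) := Nat.one_le_two_pow
    omega
  have hrep : HasDetRepr (perPoly (Fin n) ℂ) m :=
    HasDetRepr.mono_holds (hasDetRepr_determinantalComplexity_holds _) htm
  exact hn₀ n le_rfl m hnm hbound
    (paddedPerPoly_mem_orbitClosure_detPoly_of_hasDetRepr_holds hrep hnm)

/-- **Settles `stmt-ValiantsHypothesis-0983`** (`BorderApolarity.GctBridge` = `IntegralGCT.GctToVH`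
= `ValuativeGCT.GctToVH`, stated verbatim): the quasi-polynomial Mulmuley–Sohoni thesis implies
Valiant's hypothesis `VP ℂ ≠ VNP ℂ`. From step 1 and `VP ⟹ dc quasi-polynomially bounded`
(`isQPBounded_determinantalComplexity_of_isVPFamily_holds`, BCS 1997 Cor. (21.40)) the permanent
family is not a `VP` family; the hub lemma `Hub.valiantsHypothesis_of_not_isVPFamily_per` with the
renaming bridge `mem_VP_ofFintype_iff_holds` and `perFamily_mem_VNP_holds ℂ` (Valiant 1979)
concludes. [folklore] -/
theorem gctBridge_proof :
    (∀ c : ℕ, ∃ n₀ : ℕ, ∀ n ≥ n₀, ∀ (m : ℕ) [NeZero m], n ≤ m → m ≤ 2 ^ ((Nat.log 2 n + c) ^ c) → Literature.Computability.AlgebraicComplexity.paddedPerPoly ℂ n m ∉ Literature.Computability.AlgebraicComplexity.orbitClosure (Literature.Computability.AlgebraicComplexity.detPoly (Fin m) ℂ)) → ValiantsHypothesis := by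
  intro hX
  refine Summit.ValiantsHypothesis.Hub.valiantsHypothesis_of_not_isVPFamily_per ?_
    (mem_VP_ofFintype_iff_holds _) (perFamily_mem_VNP_holds ℂ)
  intro hVP
  exact not_isQPBounded_dc_per_of_thesis hX
    (isQPBounded_determinantalComplexity_of_isVPFamily_holds _ hVP)

end Summit.ValiantsHypothesis.ValiantsHypothesis.Theorems.BorderApolarityGctBridge
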